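import Mathlib
import Literature.NumberTheory.FibonacciNumbers.LucasNumbersAsModuli
import Literature.NumberTheory.FibonacciNumbers.FibonacciDivisibility

/-!
# Square Fibonacci numbers, square Lucas numbers (Cohn 1964, Theorems 1–4)

Topic `NumberTheory/FibonacciNumbers`; theorems only — no definition, no named fact. `F_n` is Mathlib's
`Nat.fib`, `L_n` the tree's `lucas`; the congruence machinery is `LucasNumbersAsModuli.lean`.

SOURCE (open scan, read by eye): J. H. E. Cohn, *Square Fibonacci numbers, etc.*, Fibonacci Quart. **2**
(1964) 109–113 [Cohn1964], § THE MAIN THEOREMS (pp. 110–113), VERBATIM: «An old conjecture about Fibonacci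
numbers is that 0, 1 and 144 are the only perfect squares. … Theorem 1. If `L_n = x²`, then `n = 1` or `3`.
Proof. If `n` is even, (3) gives `L_n = y² ± 2 ≠ x²`. If `n ≡ 1 (mod 4)`, then `L_1 = 1`, whereas if `n ≠ 1`
we can write `n = 1 + 2·3^r·k` where `k` has the required properties, and then obtain by (11)
`L_n ≡ −L_1 = −1 (mod L_k)` and so `L_n ≠ x²` since `−1` is a non-residue of `L_k` by (10). Finally, if
`n ≡ 3 (mod 4)` then `n = 3` gives `L_3 = 2²`, whereas if `n ≠ 3`, we write as before `n = 3 + 2·3^r·k` and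
obtain `L_n ≡ −L_3 = −4 (mod L_k)` and again `L_n ≠ x²`. … Theorem 2. If `L_n = 2x²`, then `n = 0` or `±6`.
Proof. If `n` is odd and `L_n` is even, then by (6) `n ≡ ±3 (mod 12)` and so, using (13) and (9),
`L_n ≡ 4 (mod 8)` and so `L_n ≠ 2x²`. Secondly, if `n ≡ 0 (mod 4)`, then `n = 0` gives `L_n = 2`, whereas if
`n ≠ 0`, `n = 2·3^r·k` and so `2L_n ≡ −2L_0 = −4 (mod L_k)` whence `2L_n ≠ y²`, i.e. `L_n ≠ 2x²`. Thirdly, if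
`n ≡ 6 (mod 8)` then `n = 6` gives `L_6 = 2·3²` whereas if `n ≠ 6`, `n = 6 + 2·3^r·k` where now `4 | k, 3 ∤ k`
and so `2L_n ≡ −2L_6 = −36 (mod L_k)` and again, `−36` is a non-residue of `L_k` using (7) and (10). …
Finally, if `n ≡ 2 (mod 8)`, then by (9) `L_{−n} = L_n` where now `−n ≡ 6 (mod 8)` and so the only
admissible value is `−n = 6`, i.e. `n = −6`. … Theorem 3. If `F_n = x²`, then `n = 0, ±1, 2` or `12`.
Proof. If `n ≡ 1 (mod 4)`, then `n = 1` gives `F_1 = 1`, whereas if `n ≠ 1`, `n = 1 + 2·3^r·k` and so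
`F_n ≡ −F_1 = −1 (mod L_k)` whence `F_n ≠ x²`. If `n ≡ 3 (mod 4)`, then by (8) `F_{−n} = F_n` and
`−n ≡ 1 (mod 4)` and as before we get only `n = −1`. If `n` is even, then by (1) `F_n = F_{½n} L_{½n}` and
so, using (4) and (5) we obtain, if `F_n = x²` either `3 | n`, `F_{½n} = 2y², L_{½n} = 2z²`. By Theorem 2,
the latter is possible only for `½n = 0, 6` or `−6`. The first two values also satisfy the former, while the
last must be rejected since it does not. or `3 ∤ n`, `F_{½n} = y², L_{½n} = z²`. By Theorem 1, the latter
is possible only for `½n = 1` or `3`, and again the second value must be rejected. … Theorem 4. If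
`F_n = 2x²`, then `n = 0, ±3` or `6`. Proof. If `n ≡ 3 (mod 4)`, then `n = 3` gives `F_3 = 2`, whereas if
`n ≠ 3`, `n = 3 + 2·3^r·k` and so `2F_n ≡ −2F_3 = −4 (mod L_k)` and so `F_n ≠ 2x²`. If `n ≡ 1 (mod 4)`
then as before `F_{−n} = F_n` and we get only `n = −3`. If `n` is even, then since `F_n = F_{½n}L_{½n}` we
must have if `F_n = 2x²` either `F_{½n} = y², L_{½n} = 2z²`; then by Theorems 2 and 3 we see that the only
value which satisfies both of these is `½n = 0` or `F_{½n} = 2y², L_{½n} = z²`; then by Theorem 1, the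
second of these is satisfied only for `½n = 1` or `3`. But the former of these does not satisfy the first
equation.»

## Rendering and deviations

* INDICES ARE NATURAL NUMBERS (`Nat.fib`, `lucas : ℕ → ℕ`): the four theorems are typed as `iff`s over
  `n : ℕ` — `isSquare_lucas_iff` (`n = 1, 3`), `lucas_eq_two_mul_sq_iff` (`n = 0, 6`), `isSquare_fib_iff`
  (`n = 0, 1, 2, 12`), `fib_eq_two_mul_sq_iff` (`n = 0, 3, 6`) — plus the Introduction's sentence
  `isSquare_fib_iff_mem` («0, 1 and 144 are the only perfect squares»). The negative solutions `n = −1, −3,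
  −6` of the printed statements are outside this rendering.
* Where Cohn passes through NEGATIVE indices ((8), (9): the cases `n ≡ 2 (mod 8)` of Thm 2, `n ≡ 3 (mod 4)`
  of Thm 3, `n ≡ 1 (mod 4)` of Thm 4) we use instead the reflected congruences `lucas_modEq_of_add_eq`,
  `fib_modEq_of_add_eq` of `LucasNumbersAsModuli.lean` (`n + 6`, `n + 1`, `n + 3 = 2·3^r·k`), which is the
  same computation read on `ℕ`.
* «`n = c + 2·3^r·k` where `k` has the required properties»: `exists_mul_odd_not_three_dvd` splits
  `j = (n − c)/2 > 0` as `j = k·t`, `t = 3^r` odd, `3 ∤ k`, with `2 | k` (resp. `4 | k`) inherited from `j`.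
* Thm 4, `n` even, `3 ∤ ½n`: both `F_{½n}` and `L_{½n}` are then odd ((6) and Hardy–Wright Thm 179 (ii)), so
  `F_{½n}L_{½n} = 2x²` is impossible outright — a shortcut replacing Cohn's appeal to Theorems 2, 3 in that
  sub-case; for `3 | ½n` we follow the printed dichotomy via `(F_{½n}, L_{½n}) = 2` ((4)).
* (3) is the tree's `lucas_two_mul_add`, (13) the tree's `lucas_add_twelve_modEq_eight`, `F_{2m} = F_mL_m`
  the tree's `fib_mul_lucas`, (4)/(5) the tree's `gcd_fib_lucas`; «a product of coprime numbers which is a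
  square has square factors» is Mathlib's `exists_eq_pow_of_mul_eq_pow`.

## References
* [Cohn1964] J. H. E. Cohn, *Square Fibonacci numbers, etc.*, Fibonacci Quart. 2 (1964) 109–113, Thms 1–4.
* [HardyWright2008] G. H. Hardy, E. M. Wright, *An Introduction to the Theory of Numbers*, Thm 179 (ii)
  (the tree's `gcd_fib_lucas`, `even_lucas_iff`).
-/

namespace Literature.NumberTheory.FibonacciNumbers

open Nat Literature.NumberTheory.ContinuedFractions.FibonacciLucas
open Literature.Combinatorics.Enumerative.BinomialCoefficientRepeatedValuesLind (fib_mul_lucas)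

/-! ### Arithmetic helpers -/

/-- «`n = c + 2·3^r·k` where `k` has the required properties»: every `j > 0` is `k·t` with `t = 3^r` odd and
`3 ∤ k`; `k` inherits the factors `2` and `4` of `j`. [cite: Cohn1964, proof of Thm 1] -/
theorem exists_mul_odd_not_three_dvd {j : ℕ} (hj : 0 < j) :
    ∃ k t, j = k * t ∧ ¬3 ∣ k ∧ Odd t ∧ (2 ∣ j → 2 ∣ k) ∧ (4 ∣ j → 4 ∣ k) := by
  have hsplit : j / 3 ^ j.factorization 3 * 3 ^ j.factorization 3 = j :=
    Nat.div_mul_cancel (Nat.ordProj_dvd j 3)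
  refine ⟨j / 3 ^ j.factorization 3, 3 ^ j.factorization 3, hsplit.symm, ?_, ?_, ?_, ?_⟩
  · exact Nat.not_dvd_ordCompl Nat.prime_three hj.ne'
  · exact Odd.pow (by decide)
  · intro h2
    have hc : Nat.Coprime 2 (3 ^ j.factorization 3) := Nat.Coprime.pow_right _ (by decide)
    refine hc.dvd_of_dvd_mul_right ?_
    rwa [hsplit]
  · intro h4
    have hc : Nat.Coprime 4 (3 ^ j.factorization 3) := Nat.Coprime.pow_right _ (by decide)
    refine hc.dvd_of_dvd_mul_right ?_
    rwa [hsplit]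

/-- «(3) gives `L_n = y² ± 2 ≠ x²`»: no square exceeds a square by `2`. -/
@[folklore] private theorem sq_ne_sq_add_two (x y : ℤ) : x ^ 2 ≠ y ^ 2 + 2 := by
  intro h
  have h4 : ∀ a b : ZMod 4, a ^ 2 ≠ b ^ 2 + 2 := by decide
  apply h4 (x : ZMod 4) (y : ZMod 4)
  exact_mod_cast congrArg (Int.cast : ℤ → ZMod 4) h

/-- «(3) gives `L_n = y² ± 2 ≠ x²`»: no square is a square minus `2`. -/
@[folklore] private theorem sq_ne_sq_sub_two (x y : ℤ) : x ^ 2 ≠ y ^ 2 - 2 := by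
  intro h
  have h4 : ∀ a b : ZMod 4, a ^ 2 ≠ b ^ 2 - 2 := by decide
  apply h4 (x : ZMod 4) (y : ZMod 4)
  exact_mod_cast congrArg (Int.cast : ℤ → ZMod 4) h

/-- «`L_n ≡ 4 (mod 8)` and so `L_n ≠ 2x²`»: `2x² ≢ 4 (mod 8)`. -/
@[folklore] private theorem ne_two_mul_sq_of_mod_eight {L : ℕ} (hL : L % 8 = 4) (x : ℕ) : L ≠ 2 * x ^ 2 := by
  intro h
  have h8 : ∀ a : ZMod 8, (4 : ZMod 8) ≠ 2 * a ^ 2 := by decide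
  apply h8 (x : ZMod 8)
  have hc : ((L : ℕ) : ZMod 8) = ((2 * x ^ 2 : ℕ) : ZMod 8) := by rw [h]
  rw [← ZMod.natCast_mod L 8, hL] at hc
  exact_mod_cast hc

/-- A product of two coprime natural numbers is a square only if both factors are squares (Mathlib's
`exists_eq_pow_of_mul_eq_pow`). -/
@[folklore] private theorem sq_and_sq_of_coprime_mul_eq_sq {a b c : ℕ} (hab : Nat.Coprime a b)
    (h : a * b = c ^ 2) : (∃ d, a = d ^ 2) ∧ ∃ e, b = e ^ 2 := by
  have hu : IsUnit (GCDMonoid.gcd a b) := by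
    rw [Nat.isUnit_iff, gcd_eq_nat_gcd]; exact hab
  have hu' : IsUnit (GCDMonoid.gcd b a) := by rwa [_root_.gcd_comm]
  exact ⟨exists_eq_pow_of_mul_eq_pow hu h, exists_eq_pow_of_mul_eq_pow hu' (by rw [mul_comm]; exact h)⟩

/-- «using (13) and (9), `L_n ≡ 4 (mod 8)`» for `n ≡ ±3 (mod 12)`. [cite: Cohn1964, proof of Thm 2] -/
theorem lucas_mod_eight_eq_four {n : ℕ} (h : n % 12 = 3 ∨ n % 12 = 9) : lucas n % 8 = 4 := by
  induction n using Nat.strong_induction_on with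
  | _ n ih =>
    rcases lt_or_ge n 12 with hlt | hge
    · interval_cases n <;> simp_all <;> decide
    · obtain ⟨k, rfl⟩ : ∃ k, n = k + 12 := ⟨n - 12, by omega⟩
      rw [lucas_add_twelve_modEq_eight k]
      exact ih k (by omega) (by omega)

/-! ### Theorem 1: square Lucas numbers -/

/-- **Theorem 1.** «If `L_n = x²`, then `n = 1` or `3`» (and `L_1 = 1`, `L_3 = 2²`).
[cite: Cohn1964, Thm 1] -/
theorem isSquare_lucas_iff (n : ℕ) : IsSquare (lucas n) ↔ n = 1 ∨ n = 3 := by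
  constructor
  · rintro ⟨x, hx⟩
    rcases Nat.even_or_odd n with ⟨m, hm⟩ | hodd
    · -- «If n is even, (3) gives L_n = y² ± 2 ≠ x²»
      exfalso
      have h3 := lucas_two_mul_add m
      rw [two_mul, ← hm, hx] at h3
      push_cast at h3
      rcases Nat.even_or_odd m with hme | hmo
      · rw [hme.neg_one_pow] at h3
        exact sq_ne_sq_sub_two x (lucas m) (by linear_combination h3)
      · rw [hmo.neg_one_pow] at h3
        exact sq_ne_sq_add_two x (lucas m) (by linear_combination h3)
    · have h13 : n % 4 = 1 ∨ n % 4 = 3 := by obtain ⟨m, rfl⟩ := hodd; omega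
      rcases h13 with h1 | h3
      · -- «If n ≡ 1 (mod 4), then L_1 = 1, whereas if n ≠ 1 …»
        obtain ⟨q, hq⟩ : ∃ q, n = 1 + 4 * q := ⟨n / 4, by omega⟩
        rcases Nat.eq_zero_or_pos q with rfl | hqpos
        · left; omega
        · exfalso
          obtain ⟨k, t, hkt, h3k, ht, h2k, -⟩ := exists_mul_odd_not_three_dvd (j := 2 * q) (by omega)
          have h2k := h2k (dvd_mul_right 2 q)
          have hn : 1 + 2 * k * t = n := by rw [hq, mul_assoc, ← hkt]; ring
          have hc := lucas_add_two_mul_mul_modEq_neg 1 (even_iff_two_dvd.mpr h2k) ht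
          rw [hn, hx, lucas_one] at hc
          push_cast at hc
          exact not_sq_modEq_neg_one_lucas h2k h3k x (by simpa [sq] using hc)
      · -- «if n ≡ 3 (mod 4) then n = 3 gives L_3 = 2², whereas if n ≠ 3 …»
        obtain ⟨q, hq⟩ : ∃ q, n = 3 + 4 * q := ⟨n / 4, by omega⟩
        rcases Nat.eq_zero_or_pos q with rfl | hqpos
        · right; omega
        · exfalso
          obtain ⟨k, t, hkt, h3k, ht, h2k, -⟩ := exists_mul_odd_not_three_dvd (j := 2 * q) (by omega)
          have h2k := h2k (dvd_mul_right 2 q)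
          have hn : 3 + 2 * k * t = n := by rw [hq, mul_assoc, ← hkt]; ring
          have hc := lucas_add_two_mul_mul_modEq_neg 3 (even_iff_two_dvd.mpr h2k) ht
          rw [hn, hx, show lucas 3 = 4 from rfl] at hc
          push_cast at hc
          exact not_sq_modEq_neg_four_lucas h2k h3k x (by simpa [sq] using hc)
  · rintro (rfl | rfl)
    · exact ⟨1, rfl⟩
    · exact ⟨2, rfl⟩

/-! ### Theorem 2: Lucas numbers of the form `2x²` -/

/-- **Theorem 2.** «If `L_n = 2x²`, then `n = 0` or `±6`» — on `ℕ`: `n = 0` or `6` (`L_0 = 2`, `L_6 = 2·3²`).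
[cite: Cohn1964, Thm 2] -/
theorem lucas_eq_two_mul_sq_iff (n : ℕ) : (∃ x, lucas n = 2 * x ^ 2) ↔ n = 0 ∨ n = 6 := by
  constructor
  · rintro ⟨x, hx⟩
    rcases Nat.even_or_odd n with heven | hodd
    · have h04 : n % 4 = 0 ∨ n % 8 = 6 ∨ n % 8 = 2 := by obtain ⟨m, rfl⟩ := heven; omega
      rcases h04 with h0 | h6 | h2
      · -- «if n ≡ 0 (mod 4), then n = 0 gives L_n = 2, whereas if n ≠ 0, n = 2·3^r·k …»
        obtain ⟨q, hq⟩ : ∃ q, n = 4 * q := ⟨n / 4, by omega⟩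
        rcases Nat.eq_zero_or_pos q with rfl | hqpos
        · left; omega
        · exfalso
          obtain ⟨k, t, hkt, h3k, ht, h2k, -⟩ := exists_mul_odd_not_three_dvd (j := 2 * q) (by omega)
          have h2k := h2k (dvd_mul_right 2 q)
          have hn : 0 + 2 * k * t = n := by rw [hq, mul_assoc, ← hkt]; ring
          have hc := (lucas_add_two_mul_mul_modEq_neg 0 (even_iff_two_dvd.mpr h2k) ht).mul_left 2
          rw [hn, hx, lucas_zero] at hc
          push_cast at hc
          exact not_sq_modEq_neg_four_lucas h2k h3k (2 * x)
            (by simpa [show ((2 : ℤ) * x) ^ 2 = 2 * (2 * (x : ℤ) ^ 2) by ring] using hc)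
      · -- «if n ≡ 6 (mod 8) then n = 6 gives L_6 = 2·3² whereas if n ≠ 6, n = 6 + 2·3^r·k, 4 | k …»
        obtain ⟨q, hq⟩ : ∃ q, n = 6 + 8 * q := ⟨n / 8, by omega⟩
        rcases Nat.eq_zero_or_pos q with rfl | hqpos
        · right; omega
        · exfalso
          obtain ⟨k, t, hkt, h3k, ht, -, h4k⟩ := exists_mul_odd_not_three_dvd (j := 4 * q) (by omega)
          have h4k := h4k (dvd_mul_right 4 q)
          have h2k : 2 ∣ k := dvd_trans (by norm_num) h4k
          have hn : 6 + 2 * k * t = n := by rw [hq, mul_assoc, ← hkt]; ring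
          have hc := (lucas_add_two_mul_mul_modEq_neg 6 (even_iff_two_dvd.mpr h2k) ht).mul_left 2
          rw [hn, hx, show lucas 6 = 18 from rfl] at hc
          push_cast at hc
          exact not_sq_modEq_neg_thirtySix_lucas h4k h3k (2 * x)
            (by simpa [show ((2 : ℤ) * x) ^ 2 = 2 * (2 * (x : ℤ) ^ 2) by ring] using hc)
      · -- «Finally, if n ≡ 2 (mod 8)» — Cohn: `L_{−n} = L_n`, `−n ≡ 6 (mod 8)`; here: `n + 6 = 2·3^r·k`.
        exfalso
        obtain ⟨q, hq⟩ : ∃ q, n + 6 = 8 * q := ⟨(n + 6) / 8, by omega⟩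
        obtain ⟨k, t, hkt, h3k, ht, -, h4k⟩ := exists_mul_odd_not_three_dvd (j := 4 * q) (by omega)
        have h4k := h4k (dvd_mul_right 4 q)
        have h2k : 2 ∣ k := dvd_trans (by norm_num) h4k
        rcases lt_or_ge n 6 with hlt | hge
        · have h2 : n = 2 := by omega
          subst h2
          have : 2 ∣ 3 := ⟨x ^ 2, by rw [show (3 : ℕ) = lucas 2 from rfl]; exact hx⟩
          omega
        · have hab : n + 6 = 2 * k * t := by rw [hq, mul_assoc, ← hkt]; ring
          have hc := (lucas_modEq_of_add_eq (even_iff_two_dvd.mpr h2k) ht hab hge).mul_left 2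
          rw [hx, show lucas 6 = 18 from rfl] at hc
          push_cast at hc
          exact not_sq_modEq_neg_thirtySix_lucas h4k h3k (2 * x)
            (by simpa [show ((2 : ℤ) * x) ^ 2 = 2 * (2 * (x : ℤ) ^ 2) by ring] using hc)
    · -- «If n is odd and L_n is even, then by (6) n ≡ ±3 (mod 12) and so … L_n ≡ 4 (mod 8)»
      exfalso
      have h3 : 3 ∣ n := (two_dvd_lucas_iff n).mp ⟨x ^ 2, hx⟩
      have h12 : n % 12 = 3 ∨ n % 12 = 9 := by obtain ⟨m, rfl⟩ := hodd; omega
      exact ne_two_mul_sq_of_mod_eight (lucas_mod_eight_eq_four h12) x hx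
  · rintro (rfl | rfl)
    · exact ⟨1, rfl⟩
    · exact ⟨3, rfl⟩

/-! ### Theorem 3: square Fibonacci numbers -/

/-- **Theorem 3.** «If `F_n = x²`, then `n = 0, ±1, 2` or `12`» — on `ℕ`: `n = 0, 1, 2` or `12`.
[cite: Cohn1964, Thm 3] -/
theorem isSquare_fib_iff (n : ℕ) : IsSquare (fib n) ↔ n = 0 ∨ n = 1 ∨ n = 2 ∨ n = 12 := by
  constructor
  · rintro ⟨x, hx⟩
    rcases Nat.even_or_odd n with ⟨m, hm⟩ | hodd
    · -- «If n is even, then by (1) F_n = F_{½n} L_{½n} and so, using (4) and (5) …»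
      rw [← two_mul] at hm
      subst hm
      have hprod : fib m * lucas m = x ^ 2 := by rw [fib_mul_lucas, hx, sq]
      by_cases h3 : 3 ∣ m
      · -- «3 | n, F = 2y², L = 2z². By Theorem 2, the latter is possible only for ½n = 0, 6»
        have h2F : 2 ∣ fib m := by
          have := Nat.fib_dvd 3 m h3; rwa [show fib 3 = 2 from rfl] at this
        have h2L : 2 ∣ lucas m := (two_dvd_lucas_iff m).mpr h3
        obtain ⟨f, hf⟩ := h2F
        obtain ⟨l, hl⟩ := h2L
        have hg : Nat.gcd (fib m) (lucas m) = 2 := gcd_fib_lucas_of_even (even_iff_two_dvd.mpr ⟨f, hf⟩)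
        have hfl : Nat.Coprime f l := by
          rw [hf, hl, Nat.gcd_mul_left] at hg
          exact Nat.coprime_iff_gcd_eq_one.mpr (by omega)
        rw [hf, hl] at hprod
        have hx2 : 2 ∣ x := by
          have : 2 ∣ x ^ 2 := ⟨2 * f * l, by rw [← hprod]; ring⟩
          exact Nat.Prime.dvd_of_dvd_pow Nat.prime_two this
        obtain ⟨w, hw⟩ := hx2
        rw [hw] at hprod
        have hflw : f * l = w ^ 2 := by
          have h4 : 4 * (f * l) = 4 * w ^ 2 := by linear_combination hprod
          omega
        obtain ⟨-, ⟨z, hz⟩⟩ := sq_and_sq_of_coprime_mul_eq_sq hfl hflw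
        have hL : ∃ y, lucas m = 2 * y ^ 2 := ⟨z, by rw [hl, hz]⟩
        rcases (lucas_eq_two_mul_sq_iff m).mp hL with rfl | rfl
        · left; rfl
        · right; right; right; rfl
      · -- «3 ∤ n, F = y², L = z². By Theorem 1, the latter is possible only for ½n = 1 or 3»
        have hodd : Odd (fib m) := by
          rw [← Nat.not_even_iff_odd, ← even_lucas_iff, even_iff_two_dvd, two_dvd_lucas_iff]; exact h3
        have hcop : Nat.Coprime (fib m) (lucas m) := gcd_fib_lucas_of_odd hodd
        obtain ⟨-, ⟨z, hz⟩⟩ := sq_and_sq_of_coprime_mul_eq_sq hcop hprod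
        rcases (isSquare_lucas_iff m).mp ⟨z, by rw [hz, sq]⟩ with rfl | rfl
        · right; right; left; rfl
        · exact absurd (dvd_refl 3) h3
    · have h13 : n % 4 = 1 ∨ n % 4 = 3 := by obtain ⟨m, rfl⟩ := hodd; omega
      rcases h13 with h1 | h3
      · -- «If n ≡ 1 (mod 4), then n = 1 gives F_1 = 1, whereas if n ≠ 1, … F_n ≡ −F_1 = −1 (mod L_k)»
        obtain ⟨q, hq⟩ : ∃ q, n = 1 + 4 * q := ⟨n / 4, by omega⟩
        rcases Nat.eq_zero_or_pos q with rfl | hqpos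
        · right; left; omega
        · exfalso
          obtain ⟨k, t, hkt, h3k, ht, h2k, -⟩ := exists_mul_odd_not_three_dvd (j := 2 * q) (by omega)
          have h2k := h2k (dvd_mul_right 2 q)
          have hn : 1 + 2 * k * t = n := by rw [hq, mul_assoc, ← hkt]; ring
          have hc := fib_add_two_mul_mul_modEq_neg 1 (even_iff_two_dvd.mpr h2k) ht
          rw [hn, hx, fib_one] at hc
          push_cast at hc
          exact not_sq_modEq_neg_one_lucas h2k h3k x (by simpa [sq] using hc)
      · -- «If n ≡ 3 (mod 4), then by (8) F_{−n} = F_n and −n ≡ 1 (mod 4)» — here: `n + 1 = 2·3^r·k`.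
        exfalso
        obtain ⟨q, hq⟩ : ∃ q, n + 1 = 4 * q := ⟨(n + 1) / 4, by omega⟩
        obtain ⟨k, t, hkt, h3k, ht, h2k, -⟩ := exists_mul_odd_not_three_dvd (j := 2 * q) (by omega)
        have h2k := h2k (dvd_mul_right 2 q)
        have hab : n + 1 = 2 * k * t := by rw [hq, mul_assoc, ← hkt]; ring
        have hc := fib_modEq_of_add_eq (even_iff_two_dvd.mpr h2k) ht hab (by omega)
        rw [hx, fib_one] at hc
        push_cast at hc
        exact not_sq_modEq_neg_one_lucas h2k h3k x (by simpa [sq] using hc)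
  · rintro (rfl | rfl | rfl | rfl)
    · exact ⟨0, rfl⟩
    · exact ⟨1, rfl⟩
    · exact ⟨1, rfl⟩
    · exact ⟨12, by decide⟩

/-- «An old conjecture about Fibonacci numbers is that 0, 1 and 144 are the only perfect squares. … I have
managed to prove the truth of the conjecture». [cite: Cohn1964, Introduction + Thm 3] -/
theorem isSquare_fib_iff_mem (n : ℕ) : IsSquare (fib n) ↔ fib n = 0 ∨ fib n = 1 ∨ fib n = 144 := by
  rw [isSquare_fib_iff]
  constructor
  · rintro (rfl | rfl | rfl | rfl)
    · left; rfl
    · right; left; rfl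
    · right; left; rfl
    · right; right; rfl
  · rintro (h | h | h)
    · left; exact Nat.fib_eq_zero.mp h
    · have hn : n = 1 ∨ n = 2 := by
        rcases lt_or_ge n 3 with hlt | hge
        · interval_cases n <;> simp_all
        · have h3 : fib 3 ≤ fib n := Nat.fib_mono hge
          rw [h, show fib 3 = 2 from rfl] at h3
          omega
      rcases hn with h1 | h2
      · right; left; exact h1
      · right; right; left; exact h2
    · right; right; right
      by_contra hne
      rcases lt_or_gt_of_ne hne with hlt | hgt
      · have hmono : fib n ≤ fib 11 := Nat.fib_mono (by omega)
        have : fib 11 = 89 := by decide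
        omega
      · have hmono : fib 13 ≤ fib n := Nat.fib_mono (by omega)
        have : fib 13 = 233 := by decide
        omega

/-! ### Theorem 4: Fibonacci numbers of the form `2x²` -/

/-- **Theorem 4.** «If `F_n = 2x²`, then `n = 0, ±3` or `6`» — on `ℕ`: `n = 0, 3` or `6`.
[cite: Cohn1964, Thm 4] -/
theorem fib_eq_two_mul_sq_iff (n : ℕ) : (∃ x, fib n = 2 * x ^ 2) ↔ n = 0 ∨ n = 3 ∨ n = 6 := by
  constructor
  · rintro ⟨x, hx⟩
    rcases Nat.even_or_odd n with ⟨m, hm⟩ | hodd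
    · rw [← two_mul] at hm
      subst hm
      have hprod : fib m * lucas m = 2 * x ^ 2 := by rw [fib_mul_lucas, hx]
      by_cases h3 : 3 ∣ m
      · have h2F : 2 ∣ fib m := by
          have := Nat.fib_dvd 3 m h3; rwa [show fib 3 = 2 from rfl] at this
        have h2L : 2 ∣ lucas m := (two_dvd_lucas_iff m).mpr h3
        obtain ⟨f, hf⟩ := h2F
        obtain ⟨l, hl⟩ := h2L
        have hg : Nat.gcd (fib m) (lucas m) = 2 := gcd_fib_lucas_of_even (even_iff_two_dvd.mpr ⟨f, hf⟩)
        have hfl : Nat.Coprime f l := by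
          rw [hf, hl, Nat.gcd_mul_left] at hg
          exact Nat.coprime_iff_gcd_eq_one.mpr (by omega)
        -- `4fl = 2x²`, so `x = 2w` and `fl = 2w²`
        rw [hf, hl] at hprod
        have hx2 : 2 ∣ x := by
          have h2 : 2 * x ^ 2 = 2 * (2 * (f * l)) := by linear_combination hprod.symm
          have : 2 ∣ x ^ 2 := ⟨f * l, by omega⟩
          exact Nat.Prime.dvd_of_dvd_pow Nat.prime_two this
        obtain ⟨w, hw⟩ := hx2
        rw [hw] at hprod
        have hflw : f * l = 2 * w ^ 2 := by
          have h4 : 4 * (f * l) = 4 * (2 * w ^ 2) := by linear_combination hprod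
          omega
        -- exactly one of the coprime `f`, `l` is even
        rcases (Nat.Prime.dvd_mul Nat.prime_two).mp (show 2 ∣ f * l from ⟨w ^ 2, hflw⟩) with h2f | h2l
        · -- «F_{½n} = y², L_{½n} = 2z²; then by Theorems 2 and 3 … ½n = 0»
          obtain ⟨f', hf'⟩ := h2f
          have hcop : Nat.Coprime f' l :=
            Nat.Coprime.coprime_dvd_left (show f' ∣ f from ⟨2, by rw [hf', mul_comm]⟩) hfl
          have hprod' : f' * l = w ^ 2 := by
            have : 2 * (f' * l) = 2 * w ^ 2 := by rw [← hflw, hf']; ring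
            omega
          obtain ⟨-, ⟨z, hz⟩⟩ := sq_and_sq_of_coprime_mul_eq_sq hcop hprod'
          have hL : ∃ y, lucas m = 2 * y ^ 2 := ⟨z, by rw [hl, hz]⟩
          rcases (lucas_eq_two_mul_sq_iff m).mp hL with rfl | rfl
          · left; rfl
          · -- `½n = 6`: `F_6 = 8` is not a square («the only value which satisfies both … is ½n = 0»)
            exfalso
            obtain ⟨⟨u, hu⟩, -⟩ := sq_and_sq_of_coprime_mul_eq_sq hcop hprod'
            have h8 : fib 6 = 8 := rfl
            have : (8 : ℕ) = 2 * (2 * u ^ 2) := by rw [← h8, hf, hf', hu]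
            have hu2 : u ^ 2 = 2 := by linarith
            have hu' : u ≤ 1 := by nlinarith
            interval_cases u <;> simp at hu2
        · -- «F_{½n} = 2y², L_{½n} = z²; then by Theorem 1 … ½n = 1 or 3. But the former …»
          obtain ⟨l', hl'⟩ := h2l
          have hcop : Nat.Coprime f l' :=
            Nat.Coprime.coprime_dvd_right (show l' ∣ l from ⟨2, by rw [hl', mul_comm]⟩) hfl
          have hprod' : f * l' = w ^ 2 := by
            have : 2 * (f * l') = 2 * w ^ 2 := by rw [← hflw, hl']; ring
            omega
          obtain ⟨-, ⟨z, hz⟩⟩ := sq_and_sq_of_coprime_mul_eq_sq hcop hprod'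
          have hL : IsSquare (lucas m) := ⟨2 * z, by rw [hl, hl', hz]; ring⟩
          rcases (isSquare_lucas_iff m).mp hL with rfl | rfl
          · exact absurd h3 (by decide)
          · right; right; rfl
      · -- `3 ∤ ½n`: `F_{½n}`, `L_{½n}` are both odd, so `F_{½n}L_{½n} ≠ 2x²`
        exfalso
        have hoddL : Odd (lucas m) := odd_lucas h3
        have hoddF : Odd (fib m) := by
          rw [← Nat.not_even_iff_odd, ← even_lucas_iff, Nat.not_even_iff_odd]; exact hoddL
        have : Odd (fib m * lucas m) := hoddF.mul hoddL
        rw [hprod] at this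
        exact (Nat.not_even_iff_odd.mpr this) (even_two_mul _)
    · have h13 : n % 4 = 3 ∨ n % 4 = 1 := by obtain ⟨m, rfl⟩ := hodd; omega
      rcases h13 with h3 | h1
      · -- «If n ≡ 3 (mod 4), then n = 3 gives F_3 = 2, whereas if n ≠ 3, … 2F_n ≡ −2F_3 = −4 (mod L_k)»
        obtain ⟨q, hq⟩ : ∃ q, n = 3 + 4 * q := ⟨n / 4, by omega⟩
        rcases Nat.eq_zero_or_pos q with rfl | hqpos
        · right; left; omega
        · exfalso
          obtain ⟨k, t, hkt, h3k, ht, h2k, -⟩ := exists_mul_odd_not_three_dvd (j := 2 * q) (by omega)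
          have h2k := h2k (dvd_mul_right 2 q)
          have hn : 3 + 2 * k * t = n := by rw [hq, mul_assoc, ← hkt]; ring
          have hc := (fib_add_two_mul_mul_modEq_neg 3 (even_iff_two_dvd.mpr h2k) ht).mul_left 2
          rw [hn, hx, show fib 3 = 2 from rfl] at hc
          push_cast at hc
          exact not_sq_modEq_neg_four_lucas h2k h3k (2 * x)
            (by simpa [show ((2 : ℤ) * x) ^ 2 = 2 * (2 * (x : ℤ) ^ 2) by ring] using hc)
      · -- «If n ≡ 1 (mod 4) then as before F_{−n} = F_n and we get only n = −3» — here: `n + 3 = 2·3^r·k`.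
        exfalso
        obtain ⟨q, hq⟩ : ∃ q, n + 3 = 4 * q := ⟨(n + 3) / 4, by omega⟩
        obtain ⟨k, t, hkt, h3k, ht, h2k, -⟩ := exists_mul_odd_not_three_dvd (j := 2 * q) (by omega)
        have h2k := h2k (dvd_mul_right 2 q)
        rcases lt_or_ge n 3 with hlt | hge
        · have h1' : n = 1 := by omega
          subst h1'
          have : 2 ∣ 1 := ⟨x ^ 2, by simpa using hx⟩
          omega
        · have hab : n + 3 = 2 * k * t := by rw [hq, mul_assoc, ← hkt]; ring
          have hc := (fib_modEq_of_add_eq (even_iff_two_dvd.mpr h2k) ht hab hge).mul_left 2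
          rw [hx, show fib 3 = 2 from rfl] at hc
          push_cast at hc
          exact not_sq_modEq_neg_four_lucas h2k h3k (2 * x)
            (by simpa [show ((2 : ℤ) * x) ^ 2 = 2 * (2 * (x : ℤ) ^ 2) by ring] using hc)
  · rintro (rfl | rfl | rfl)
    · exact ⟨0, rfl⟩
    · exact ⟨1, rfl⟩
    · exact ⟨2, rfl⟩

end Literature.NumberTheory.FibonacciNumbers
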